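import Summits.QuantumFields.YangMills.Theorems.BalabanUVNodesN07SymTauCellRowOfFinePlaquettes
import Literature.MathematicalPhysics.QuantumFieldTheory.Balaban1983to89.Node00.TorusCoverLandau153RecTowerMember
import Literature.MathematicalPhysics.QuantumFieldTheory.Balaban1983to89.B8BlockConstantLiftDentedRec
import HarnessLib

/-!
# N07 [B11] (= [15] = [Balaban1985Variational]) Sect. F ∕ [6] p. 98, (1.29), (1.131) ∕ [I] (0.1)–(0.3) — **THE RECORD CUBE's COLLAR `□̃` IS THE ALIGNED WINDOW OF THE (σ2) SUPPLIER,
# AND EVERY (1.29)-CELL's ANCHORED BOX LIES IN IT**: the geometric data `Y`, `hY`, `hyY` of `…N07SymTauCellRowOfFinePlaquettes` §3 for a dented record cube `c`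

Cell `pub-ymgap`, width seat `pub-ymgap-dag-n07-w3` g13 (junction side of the K0 road; (σ2) geometry at the datum).  `--kind proof --supports stmt-QuantumFields-20541 --as helper` (K0⁷;
count-neutral; THEOREMS ONLY, 0 `def`).  [6] = [Balaban1985RegularSpaces]; [15] = [Balaban1985Variational]; [I] = [Balaban1987RG1].  CONSUMED BY NAME: this seat's `…N07SymTauCellRowOfFinePlaquettes` (capstone §3), ✓p758023
`…N07TowerBoxPlaquettesOfAlignedRegion` (floor-division bookkeeping, `blockMap_pow_anchor_of_underZ`'s splitting), g10's `Node00.TorusCoverLandau153RecTower{,Member}`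
(`CubeB8DZ.sq_zero_subset_tcube`, `image_coverShift_tcubeZ`), dag-n05-e's ✓p748893 `B8BlockConstantLiftDentedRec.mem_sq_zero_of_underZ_lamS`, `B8Eq131Cubes.{tcube, tcube_eq, bLo, bHi}`,
`B8Eq131CubesRecDictionary.mem_tcubeZ_iff_add_ctrShift`, dag-n05-d's `B8Eq119TwistedAxialRec.{UnderZ, flmZ, underZ_iff_flmZ_eq, ctrShift_add}`, `QuantumLattice.blockMap`.

WHY.  The (σ2) capstone (`…N07SymTauCellRowOfFinePlaquettes` §3) asks, per cell anchor `y` at depth `j′ ≤ k`, for an `L^k`-ALIGNED `Y ⊆ ℤᵈ` with `π '' Y ⊆ Ω′` containing the cell's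
anchored box `{x | ⌊x∕L^{j′}⌋ = y + c_{k−j′}·𝟙}`.  At a dented record cube `c` (print's datum: `□̃ = tcube L a M ρ k`, the collar of `□`; [6] p. 98) the natural window is `Y := □̃` itself
(in the anchored = uncentred coordinates of the engine cube): (1) `□̃ = [L^k(a − 2ρ), L^k(a + M + 2ρ) − 1]ᵈ` is a union of `L^k`-boxes (`tcube_eq`), hence aligned; (2) its image
`π '' □̃` lies in `Ω_{j−1}` by the knit's collar inclusion (✓p745548's `hcollar`, displayed); (3) a point `x` of the cell's anchored box has `x − c_k·𝟙` UNDER `y` (the converse of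
✓p758023's `blockMap_pow_anchor_of_underZ`), hence in `Ω′₀ = c.sq 0` (n05-e's `mem_sq_zero_of_underZ_lamS`, `y ∈ Λ′_{j′}`), hence in `□̃ᶻ` (`sq_zero_subset_tcube`), i.e. `x ∈ □̃`
(`mem_tcubeZ_iff_add_ctrShift`).  Pure bookkeeping: NO estimate of [6]∕[15]∕[I].

WHAT IS PROVED (sorry-free; every `Params`, odd `L ≥ 2`).
§1 `box_mul_aligned` (a box `[Q·α, Q·β − 1]` is `Q`-aligned), ★ `tcube_aligned` (`□̃` is `L^k`-aligned).
§2 ★ `underZ_sub_anchor_of_blockMap_pow` (`⌊x∕L^{j′}⌋ = y + c_{k−j′}·𝟙`, `j′ ≤ k` ⇒ `x − c_k·𝟙` under `y` at depth `j′`).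
§3 ★★★ `anchoredBox_subset_tcube_of_mem_lamS` (for `y ∈ c.lamS j′`, `j′ ≤ c.k`: the cell's anchored box ⊆ `tcube L c.a c.M c.ρ c.k`) — the `hyY` binder of the capstone's §3 with
   `Y := □̃`; `cover_image_tcube_eq_coverShift_image_tcubeZ` (`π '' □̃ = (x ↦ π(x + c_k·𝟙)) '' □̃ᶻ`, g10, restated for the knit's `hYΩ` bookkeeping).
§4 ★★★ `hpt_lift_at_recordCube_cell` ∕ ★★★ `norm_uavgZ_one_lift_mul_inv_mul_sub_one_le_at_recordCube_cell` — the capstone ✓`…N07SymTauCellRowOfFinePlaquettes` §3 at `Y := □̃`: the (σ2) row and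
   ✓p755807's cell bound at a (1.29)-cell `y ∈ c.lamS j′` of a dented record cube, hypotheses = `c`, `hy`, `hcollar : π '' □̃ ⊆ Ω_c`, ONE fine letter on `plaqsOf Ω_c`, two axialities, numerics, u₀-side.
§5 ★★ `lift_mul_inv_eq_tau_mul_hinv_mul_of_door` — the glue identity: on the window, the lift of the row-9′ field `g₁·u′⁻¹` IS `τ·h⁻¹·u₀` (door's `hsid` + `vfix = lift g₂` + `um = h⁻¹·u₀`).
HONEST FRAMING: count-neutral helper; set bookkeeping — nothing of [6]∕[15]∕[I] asserted or discharged; the collar inclusion `π '' □̃ ⊆ Ω_{j−1}`, the fine letter, the axialities and the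
(σ1) letters remain DISPLAYED hypotheses of the junction's knit; `NrmSymPhiOfRecord` ∕ `HThm4RecSym152PhiE(G)` ∕ `HThm4Rec*` UNDISCHARGED; N05 ∕ N07 NOT discharged; K0⁷ ∕ K1⁹ NOT closed;
counts unmoved (typed 28∕28 · discharged 8∕28); one finite 𝕋⁴ programme at fixed ε — R4 closes the conditional finite-𝕋⁴ rung `BalabanLadder.UV` only; the YM mass gap (Clay) is NOT
proved by any of this; nothing continuum ∕ ℝ⁴ ∕ OS.  No `def`, no `instance`, no `notation`, no `sorry`.

References: [6] p. 98 («□̃»), (1.29) p. 81, (1.131) p. 99; [15] (147)–(150) p. 301; [I] (0.1) p. 251, (0.3) p. 252.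
-/

set_option autoImplicit false

noncomputable section

namespace Summit.QuantumFields.YangMills.BalabanUVNodes.N07RecordCubeTowerWindow

open Literature.MathematicalPhysics.QuantumFieldTheory.Balaban1983to89
open Literature.MathematicalPhysics.QuantumFieldTheory.Balaban1983to89.Node00
open Literature.MathematicalPhysics.QuantumLattice (blockMap)
open BlockAveragingZd (ctrShift)
open B8Eq119TwistedAxialRec (UnderZ flmZ underZ_iff_flmZ_eq ctrShift_add)
open B7Prop1Local (InBox)
open B8Eq131Cubes (tcube tcube_eq bLo bHi)
open B8Eq131CubesRec (tcubeZ)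
open B8Eq131CubesRecDictionary (mem_tcubeZ_iff_add_ctrShift)
open B8BlockConstantLiftDentedRec (mem_sq_zero_of_underZ_lamS)
open B15Eq112TorusCover (cover)
open B14DomainGeom (Pt)
open N07TowerCentresCoverPointwise (blockMap_add_smul_const)

variable {P : Params}

/-! ## §1  Boxes of `Q`-blocks are aligned; `□̃` is `L^k`-aligned -/

/-- A box `[Q·α, Q·β − 1]` (coordinatewise) contains with every point its whole `Q`-block (`Q > 0`). [cite: Balaban1987RG1, (0.3) p.252 (bookkeeping)] -/
theorem box_mul_aligned (Q : ℕ) (hQ : 0 < Q) (α β : Pt P.d) :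
    ∀ x ∈ {x : Pt P.d | ∀ i, (Q : ℤ) * α i ≤ x i ∧ x i ≤ (Q : ℤ) * β i - 1}, ∀ z : Pt P.d, blockMap Q z = blockMap Q x →
      z ∈ {x : Pt P.d | ∀ i, (Q : ℤ) * α i ≤ x i ∧ x i ≤ (Q : ℤ) * β i - 1} := by
  intro x hx z hz i
  have hQ' : (0 : ℤ) < Q := by exact_mod_cast hQ
  obtain ⟨h1, h2⟩ := hx i
  have htz : z i / (Q : ℤ) = x i / (Q : ℤ) := congr_fun hz i
  have hα : α i ≤ x i / (Q : ℤ) := (Int.le_ediv_iff_mul_le hQ').2 (by linarith)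
  have hβ : x i / (Q : ℤ) < β i := (Int.ediv_lt_iff_lt_mul hQ').2 (by linarith)
  have hz1 : (Q : ℤ) * (z i / (Q : ℤ)) ≤ z i := Int.mul_ediv_self_le hQ'.ne'
  have hz2 : z i < (Q : ℤ) * (z i / (Q : ℤ)) + Q := Int.lt_mul_ediv_self_add hQ'
  rw [htz] at hz1 hz2
  have hlo : (Q : ℤ) * α i ≤ (Q : ℤ) * (x i / (Q : ℤ)) := mul_le_mul_of_nonneg_left hα hQ'.le
  have hhi : (Q : ℤ) * (x i / (Q : ℤ) + 1) ≤ (Q : ℤ) * β i := mul_le_mul_of_nonneg_left (by omega) hQ'.le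
  constructor
  · linarith
  · linarith

/-- ★ **`□̃` IS `L^k`-ALIGNED**: the record cube's collar `tcube L a M ρ k = [L^k(a − 2ρ), L^k(a + M + 2ρ) − 1]ᵈ` contains with every fine point its whole `L^k`-box.
[cite: Balaban1985RegularSpaces, p.98 («□̃ … a sum of the big blocks»); Balaban1987RG1, (0.3) p.252] -/
theorem tcube_aligned (a : Pt P.d) (M ρ k : ℕ) :
    ∀ x ∈ tcube P.L a M ρ k, ∀ z : Pt P.d, blockMap (P.L ^ k) z = blockMap (P.L ^ k) x → z ∈ tcube P.L a M ρ k := by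
  intro x hx z hz
  have hQ : 0 < P.L ^ k := pow_pos P.L_pos _
  have key := box_mul_aligned (P := P) (P.L ^ k) hQ (fun i => a i - 2 * (ρ : ℤ)) (fun i => a i + M + 2 * (ρ : ℤ)) x ?_ z hz
  · rw [tcube_eq]
    intro i
    obtain ⟨h1, h2⟩ := key i
    simp only [bLo, bHi]
    push_cast at h1 h2 ⊢
    have e1 : (P.L : ℤ) ^ k * (a i - 2 * (ρ : ℤ)) = (P.L : ℤ) ^ k * a i - (P.L : ℤ) ^ k * (2 * (ρ : ℤ)) := by ring
    have e2 : (P.L : ℤ) ^ k * (a i + M + 2 * (ρ : ℤ)) = (P.L : ℤ) ^ k * (a i + M) + (P.L : ℤ) ^ k * (2 * (ρ : ℤ)) := by ring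
    constructor <;> linarith
  · rw [tcube_eq] at hx
    intro i
    obtain ⟨h1, h2⟩ := hx i
    simp only [bLo, bHi] at h1 h2
    push_cast at h1 h2 ⊢
    have e1 : (P.L : ℤ) ^ k * (a i - 2 * (ρ : ℤ)) = (P.L : ℤ) ^ k * a i - (P.L : ℤ) ^ k * (2 * (ρ : ℤ)) := by ring
    have e2 : (P.L : ℤ) ^ k * (a i + M + 2 * (ρ : ℤ)) = (P.L : ℤ) ^ k * (a i + M) + (P.L : ℤ) ^ k * (2 * (ρ : ℤ)) := by ring
    constructor <;> linarith

/-! ## §2  A point of the anchored box of a cell lies, un-anchored, under the cell -/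

/-- ★ **THE CONVERSE ANCHOR LEMMA**: if `⌊x∕L^{j′}⌋ = y + c_{k−j′}·𝟙` and `j′ ≤ k`, then `x − c_k·𝟙` is under `y` at depth `j′` (`c_k = L^{j′}·c_{k−j′} + c_{j′}`, odd `L`).
[cite: Balaban1987RG1, (0.1) p.251, (0.3) p.252; Balaban1985RegularSpaces, (1.19) p.79] -/
theorem underZ_sub_anchor_of_blockMap_pow {k j : ℕ} (hjk : j ≤ k) {y x : Pt P.d}
    (hx : blockMap (P.L ^ j) x = y + fun _ => ((ctrShift P.L (k - j) : ℕ) : ℤ)) :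
    UnderZ P.L j y (x - fun _ => ((ctrShift P.L k : ℕ) : ℤ)) := by
  set w : Pt P.d := x - fun _ => ((ctrShift P.L k : ℕ) : ℤ) with hw
  have hxw : x = w + fun _ => ((ctrShift P.L k : ℕ) : ℤ) := by rw [hw, sub_add_cancel]
  have hc : (ctrShift P.L k : ℤ) = (P.L : ℤ) ^ j * ctrShift P.L (k - j) + ctrShift P.L j := by
    have h := ctrShift_add P.hL.1 (k - j) j
    rwa [Nat.sub_add_cancel hjk] at h
  have hsplit : (w + fun _ => ((ctrShift P.L k : ℕ) : ℤ)) =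
      (w + fun _ => ((ctrShift P.L j : ℕ) : ℤ)) + fun _ => ((P.L ^ j : ℕ) : ℤ) * (ctrShift P.L (k - j) : ℤ) := by
    funext μ
    simp only [Pi.add_apply, hc]
    push_cast
    ring
  rw [hxw, hsplit, blockMap_add_smul_const (P.L ^ j) (pow_pos P.L_pos _), blockMap_pow_add_ctrShift] at hx
  exact (underZ_iff_flmZ_eq P.hL.1 j y w).2 (add_right_cancel hx)

/-! ## §3  The cell's anchored box lies in `□̃` -/

/-- ★★★ **THE `hyY` BINDER AT A DENTED RECORD CUBE**: for a cube `c : CubeB8DZ` and a (1.29)-cell `y ∈ Λ′_{j′}` (`c.lamS j′`, `j′ ≤ c.k`), the cell's anchored `L^{j′}`-box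
`{x | ⌊x∕L^{j′}⌋ = y + c_{k−j′}·𝟙}` is contained in the collar `□̃ = tcube L c.a c.M c.ρ c.k`: its points, un-anchored, are under `y` (§2), hence in `Ω′₀` (n05-e's
`mem_sq_zero_of_underZ_lamS`), hence in `□̃ᶻ` (`sq_zero_subset_tcube`), i.e. anchored in `□̃`. [cite: Balaban1985RegularSpaces, p.98, (1.29) p.81, (1.131) p.99; Balaban1985Variational, (147)–(150) p.301; Balaban1987RG1, (0.3) p.252] -/
theorem anchoredBox_subset_tcube_of_mem_lamS {K' : ℕ} {Ω' : ℕ → Set (B7Prop1Explicit.Site P.d)} (c : CubeB8DZ P.d P.L K' Ω') {j : ℕ} (hj : j ≤ c.k)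
    {y : Pt P.d} (hy : y ∈ c.lamS j) :
    {x : Pt P.d | blockMap (P.L ^ j) x = y + fun _ => ((ctrShift P.L (c.k - j) : ℕ) : ℤ)} ⊆ tcube P.L c.a c.M c.ρ c.k := by
  intro x hx
  have hw := underZ_sub_anchor_of_blockMap_pow (P := P) hj hx
  have h0 := mem_sq_zero_of_underZ_lamS P.hL.1 c hj hy hw
  have ht : (x - fun _ => ((ctrShift P.L c.k : ℕ) : ℤ)) ∈ tcubeZ P.L c.a c.M c.ρ c.k := CubeB8DZ.sq_zero_subset_tcube P.hL.1 P.hL.2 c h0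
  have h := (mem_tcubeZ_iff_add_ctrShift P.hL.1 c.a c.M c.ρ c.k _).1 ht
  rwa [sub_add_cancel] at h

/-- `π '' □̃ = (x ↦ π(x + c_k·𝟙)) '' □̃ᶻ` (g10's `image_coverShift_tcubeZ`, restated in the direction the knit reads its collar inclusion `hcollar : π '' □̃ ⊆ Ω_{j−1}`).
[cite: Balaban1987RG1, (0.1) p.251, (0.3) p.252; Balaban1985RegularSpaces, p.98] -/
theorem cover_image_tcube_eq_coverShift_image_tcubeZ (a : Pt P.d) (M ρ k : ℕ) :
    cover P '' tcube P.L a M ρ k = (fun x => cover P (x + fun _ => (ctrShift P.L k : ℤ))) '' tcubeZ P.L a M ρ k :=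
  (image_coverShift_tcubeZ a M ρ k).symm

/-! ## §4  Composition with the capstone: the (σ2) row and the cell bound AT A CELL OF A DENTED RECORD CUBE -/

section AtRecordCube

open scoped BigOperators Matrix.Norms.L2Operator
open T4Continuum (T4Family)
open GaugeField (gaugeAct)
open ExpMeanLog (deltaSU)
open B7Prop2Explicit (unitaryUnits)
open B7SectCDGaugeAveragesRec (uavgZ)
open B8Eq17ClassAkV1 (plaqsOf)
open B8Eq119TwistedAxialRec (UnderZ)
open Summit.QuantumFields.Balaban3D.Carriers (radialContourData)
open Summit.QuantumFields.YangMills.BalabanUVNodes.N07NormalisationSymOfRecord (symCd)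
open Summit.QuantumFields.YangMills.BalabanUVNodes.N07SymTauCellRowOfFinePlaquettes (hpt_lift_of_fineLetter_aligned norm_uavgZ_one_lift_mul_inv_mul_sub_one_le_of_fineLetter_aligned)

variable {F : T4Family} (N : ℕ) [NeZero N]

/-- ★★★ **THE (σ2) ROW AT A CELL OF A DENTED RECORD CUBE** — the capstone's `hpt_lift_of_fineLetter_aligned` with `Y := □̃ = tcube L c.a c.M c.ρ c.k` (`tcube_aligned`) and
`hyY :=` §3: hypotheses are the cube `c`, a (1.29)-cell `y ∈ c.lamS j′` (`j′ ≤ c.k ≤ m + K`), the collar inclusion `π '' □̃ ⊆ Ω_c` (the knit's `hcollar`, DISPLAYED), ONE fine letter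
`PlaqSmallOn (plaqsOf Ω_c) a₀ U`, the two axialities (`n < c.k`), the per-level numerics and the geometric schedule; conclusion VERBATIM the `hpt`∕`hptτ` binder of ✓p753816 ∕ ✓p755807 for the
lift of `g₁·g₂⁻¹` anchored at `c_{c.k}`, at `(j′, y)`.
[cite: Balaban1985RegularSpaces, p.98, (1.29) p.81, (1.131) p.99, (1.19) p.79; Balaban1985Variational, (147)–(154) pp.301–302; Balaban1987RG1, (0.1) p.251, (0.3)–(0.4) pp.252–253, (0.11) p.253] -/
theorem hpt_lift_at_recordCube_cell {K K' : ℕ} {Ω' : ℕ → Set (B7Prop1Explicit.Site (F.P K).d)} (c : CubeB8DZ (F.P K).d (F.P K).L K' Ω')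
    (hk : c.k ≤ (F.P K).m + (F.P K).K) (U : GaugeField (F.P K) 0 (SU N)) (g₁ g₂ : GaugeTransf (F.P K) 0 (SU N))
    (hax₁ : ∀ n, n < c.k → AxialGauge (symCd F N K n) (Averaging.iter (avOfRecord F N K) n (gaugeAct g₁ U)))
    (hax₂ : ∀ n, n < c.k → AxialGauge (radialContourData (F.P K) n (SU N)) (Averaging.iter (avOfRecord F N K) n (gaugeAct g₂ U)))
    (hN : ∀ n, n < c.k → (F.P K).L < (F.P K).sitesPerDir n)
    {a₀ : ℝ} (ha₀ : 0 ≤ a₀) {Ωc : Set (Site (F.P K) 0)} (hU : PlaqSmallOn (plaqsOf Ωc) a₀ U)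
    (hcollar : cover (F.P K) '' tcube (F.P K).L c.a c.M c.ρ c.k ⊆ Ωc)
    (a : ℕ → ℝ) (ha : ∀ n, 0 ≤ a n)
    (hbud : ∀ n, n < c.k →
      6400 * ((((F.P K).d + 2) * (F.P K).L : ℕ) : ℝ) ^ 2 * ((F.P K).L : ℝ) ^ (n + 1) * (((((F.P K).d - 1 : ℕ) : ℝ)) * ((((F.P K).L ^ (n + 1) - 1 : ℕ) : ℝ)) * a₀) ≤ 1)
    (hgd : ∀ n, n < c.k →
      30 * ((((F.P K).d + 2) * (F.P K).L : ℕ) : ℝ) ^ 2 * ((F.P K).L : ℝ) ^ (n + 1) * (((((F.P K).d - 1 : ℕ) : ℝ)) * ((((F.P K).L ^ (n + 1) - 1 : ℕ) : ℝ)) * a₀) < deltaSU (Fin N))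
    (haa : ∀ n, n < c.k →
      120 * ((((F.P K).d + 2) * (F.P K).L : ℕ) : ℝ) * ((F.P K).L : ℝ) ^ n * (((((F.P K).d - 1 : ℕ) : ℝ)) * ((((F.P K).L ^ (n + 1) - 1 : ℕ) : ℝ)) * a₀) < a n)
    (h100 : ∀ n, n < c.k → 2 * ((((F.P K).d * (((F.P K).L - 1) / 2) : ℕ) : ℝ) * (((((F.P K).d - 1 : ℕ) : ℝ) * (((F.P K).L - 1 : ℕ) : ℝ)) * a n)) ≤ 1 / 100)
    (hguard : ∀ n, n < c.k →
      2 * ((((F.P K).d * (((F.P K).L - 1) / 2) : ℕ) : ℝ) * (((((F.P K).d - 1 : ℕ) : ℝ) * (((F.P K).L - 1 : ℕ) : ℝ)) * a n)) < (FederbushMean.federbushSU (n := Fin N)).δ)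
    {ω θ : ℝ} (hθ0 : 0 ≤ θ) (hθ : θ ≤ 1 / 2) (hω0 : 0 ≤ ω)
    (hE : ∀ m, m < c.k → 4 * (2 * ((((F.P K).d * (((F.P K).L - 1) / 2) : ℕ) : ℝ) * (((((F.P K).d - 1 : ℕ) : ℝ) * (((F.P K).L - 1 : ℕ) : ℝ)) * a m))) ≤
      ω / 2 * θ ^ (c.k - (m + 1)))
    {j : ℕ} (hjk : j ≤ c.k) {y : Pt (F.P K).d} (hy : y ∈ c.lamS j) :
    ∀ i, i < j → ∀ z, UnderZ (F.P K).L (j - (i + 1)) y z → ∀ w, UnderZ (F.P K).L (i + 1) z w →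
      ‖(((((fun x => ιSU N ((fun x' => g₁ x' * (g₂ x')⁻¹) (cover (F.P K) (x + fun _ => ((ctrShift (F.P K).L c.k : ℕ) : ℤ)))))
              ((((F.P K).L : ℤ) ^ (i + 1)) • z))⁻¹ *
          (fun x => ιSU N ((fun x' => g₁ x' * (g₂ x')⁻¹) (cover (F.P K) (x + fun _ => ((ctrShift (F.P K).L c.k : ℕ) : ℤ))))) w : (MatA N)ˣ)) : MatA N) - 1‖ ≤
        ω * θ ^ (j - (i + 1)) :=
  hpt_lift_of_fineLetter_aligned N hk U g₁ g₂ hax₁ hax₂ hN ha₀ hU (tcube_aligned c.a c.M c.ρ c.k) hcollar a ha hbud hgd haa h100 hguard hθ0 hθ hω0 hE hjk y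
    (anchoredBox_subset_tcube_of_mem_lamS c hjk hy)

/-- ★★★ **THE CELL's CROSS-TERM BOUND AT A DENTED RECORD CUBE, `τ`-SIDE FROM THE TORUS** — ✓p755807's `‖R̄₀^{j′}(τ·h⁻¹·u)(y) − 1‖ ≤ 1024·(4(ω_τ + ω_u))²` for the anchored lift `τ` of
`g₁·g₂⁻¹` at a (1.29)-cell `y ∈ c.lamS j′` of the cube `c`, with the `τ`-side read from the torus data (collar inclusion, one fine letter, two axialities, numerics) and the `u₀`-side
((σ1): `hu`, `hptu`, `hu1`), `h ≡ R̄₀^{j′}τ(y)` under `y` and the cell numerics DISPLAYED.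
[cite: Balaban1985Averaging, (78)–(81) p.30, (167) p.44; Balaban1985RegularSpaces, p.98, (1.29) p.81; Balaban1987RG1, (0.3)–(0.4) pp.252–253, (0.11) p.253; Balaban1985Variational, (147)–(154) pp.301–302] -/
theorem norm_uavgZ_one_lift_mul_inv_mul_sub_one_le_at_recordCube_cell {K K' : ℕ} {Ω' : ℕ → Set (B7Prop1Explicit.Site (F.P K).d)} (c : CubeB8DZ (F.P K).d (F.P K).L K' Ω')
    (hk : c.k ≤ (F.P K).m + (F.P K).K) (U : GaugeField (F.P K) 0 (SU N))
    (g₁ g₂ : GaugeTransf (F.P K) 0 (SU N))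
    (hax₁ : ∀ n, n < c.k → AxialGauge (symCd F N K n) (Averaging.iter (avOfRecord F N K) n (gaugeAct g₁ U)))
    (hax₂ : ∀ n, n < c.k → AxialGauge (radialContourData (F.P K) n (SU N)) (Averaging.iter (avOfRecord F N K) n (gaugeAct g₂ U)))
    (hN : ∀ n, n < c.k → (F.P K).L < (F.P K).sitesPerDir n)
    {a₀ : ℝ} (ha₀ : 0 ≤ a₀) {Ωc : Set (Site (F.P K) 0)} (hU : PlaqSmallOn (plaqsOf Ωc) a₀ U)
    (hcollar : cover (F.P K) '' tcube (F.P K).L c.a c.M c.ρ c.k ⊆ Ωc)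
    (a : ℕ → ℝ) (ha : ∀ n, 0 ≤ a n)
    (hbud : ∀ n, n < c.k →
      6400 * ((((F.P K).d + 2) * (F.P K).L : ℕ) : ℝ) ^ 2 * ((F.P K).L : ℝ) ^ (n + 1) * (((((F.P K).d - 1 : ℕ) : ℝ)) * ((((F.P K).L ^ (n + 1) - 1 : ℕ) : ℝ)) * a₀) ≤ 1)
    (hgd : ∀ n, n < c.k →
      30 * ((((F.P K).d + 2) * (F.P K).L : ℕ) : ℝ) ^ 2 * ((F.P K).L : ℝ) ^ (n + 1) * (((((F.P K).d - 1 : ℕ) : ℝ)) * ((((F.P K).L ^ (n + 1) - 1 : ℕ) : ℝ)) * a₀) < deltaSU (Fin N))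
    (haa : ∀ n, n < c.k →
      120 * ((((F.P K).d + 2) * (F.P K).L : ℕ) : ℝ) * ((F.P K).L : ℝ) ^ n * (((((F.P K).d - 1 : ℕ) : ℝ)) * ((((F.P K).L ^ (n + 1) - 1 : ℕ) : ℝ)) * a₀) < a n)
    (h100 : ∀ n, n < c.k → 2 * ((((F.P K).d * (((F.P K).L - 1) / 2) : ℕ) : ℝ) * (((((F.P K).d - 1 : ℕ) : ℝ) * (((F.P K).L - 1 : ℕ) : ℝ)) * a n)) ≤ 1 / 100)
    (hguard : ∀ n, n < c.k →
      2 * ((((F.P K).d * (((F.P K).L - 1) / 2) : ℕ) : ℝ) * (((((F.P K).d - 1 : ℕ) : ℝ) * (((F.P K).L - 1 : ℕ) : ℝ)) * a n)) < (FederbushMean.federbushSU (n := Fin N)).δ)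
    {ωτ ωu θ : ℝ} (hθ0 : 0 ≤ θ) (hθ : θ ≤ 1 / 8) (hωτ0 : 0 ≤ ωτ) (hωu0 : 0 ≤ ωu) (hω : ωτ + ωu ≤ 1 / 512) (hθω : 4096 * θ * (ωτ + ωu) ≤ 1)
    (hE : ∀ m, m < c.k → 4 * (2 * ((((F.P K).d * (((F.P K).L - 1) / 2) : ℕ) : ℝ) * (((((F.P K).d - 1 : ℕ) : ℝ) * (((F.P K).L - 1 : ℕ) : ℝ)) * a m))) ≤
      ωτ / 2 * θ ^ (c.k - (m + 1)))
    {j : ℕ} (hjk : j ≤ c.k) {y : Pt (F.P K).d} (hy : y ∈ c.lamS j)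
    (h u : Pt (F.P K).d → (MatA N)ˣ)
    (hu : letI : CStarAlgebra (MatA N) := {}; ∀ x, UnderZ (F.P K).L j y x → u x ∈ unitaryUnits (MatA N))
    (hh : ∀ x, UnderZ (F.P K).L j y x →
      h x = uavgZ (F.P K).L (1 : Pt (F.P K).d → Fin (F.P K).d → (MatA N)ˣ)
        (fun x => ιSU N ((fun x' => g₁ x' * (g₂ x')⁻¹) (cover (F.P K) (x + fun _ => ((ctrShift (F.P K).L c.k : ℕ) : ℤ))))) j y)
    (hptu : ∀ i, i < j → ∀ z, UnderZ (F.P K).L (j - (i + 1)) y z → ∀ w, UnderZ (F.P K).L (i + 1) z w →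
      ‖((((u ((((F.P K).L : ℤ) ^ (i + 1)) • z))⁻¹ * u w : (MatA N)ˣ)) : MatA N) - 1‖ ≤ ωu * θ ^ (j - (i + 1)))
    (hu1 : uavgZ (F.P K).L (1 : Pt (F.P K).d → Fin (F.P K).d → (MatA N)ˣ) u j y = 1) :
    ‖((uavgZ (F.P K).L (1 : Pt (F.P K).d → Fin (F.P K).d → (MatA N)ˣ)
        ((fun x => ιSU N ((fun x' => g₁ x' * (g₂ x')⁻¹) (cover (F.P K) (x + fun _ => ((ctrShift (F.P K).L c.k : ℕ) : ℤ))))) * h⁻¹ * u) j y : (MatA N)ˣ) :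
          MatA N) - 1‖ ≤ 1024 * (4 * (ωτ + ωu)) ^ 2 :=
  norm_uavgZ_one_lift_mul_inv_mul_sub_one_le_of_fineLetter_aligned N hk U g₁ g₂ hax₁ hax₂ hN ha₀ hU (tcube_aligned c.a c.M c.ρ c.k) hcollar a ha hbud hgd haa h100
    hguard hθ0 hθ hωτ0 hωu0 hω hθω hE hjk y (anchoredBox_subset_tcube_of_mem_lamS c hjk hy) h u hu hh hptu hu1


/-! ## §5  The glue identity: the junction's row-9′ field IS `τ·h⁻¹·u₀` on the window -/

omit [NeZero N] in
/-- ★★ **THE GLUE IDENTITY** (pointwise group algebra): if on a set `X` the door's member identity reads `ιSU(u′(π(x + c_k·𝟙))) = (um x)⁻¹·vfix x` (✓p758087's `hsid`), the crown's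
radial gauge is the lift of `g₂` there (`vfix x = ιSU(g₂(π(x + c_k·𝟙)))`, g10's `…N07TowerGaugeCoverLift`) and `um = h⁻¹·u₀` (the pre-composed crown's gauge function), then the lift of
the torus function `g₁·u′⁻¹` — the field whose `R̄^{j′}` row 9′ (`NrmSymPhiOfRecord`) reads — equals `τ·h⁻¹·u₀` on `X`, `τ := ιSU ∘ (g₁·g₂⁻¹) ∘ π ∘ (· + c_k·𝟙)` (the field of
`norm_uavgZ_one_lift_mul_inv_mul_sub_one_le_at_recordCube_cell`); with FILE 40c v1.3 `uavgZ_one_congr_at` the two cell averages agree whenever the cell's tower lies in `X`.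
[cite: Balaban1985RegularSpaces, (1.29) p.81, Prop. 6 (1.137) p.99; Balaban1987RG1, (0.3)–(0.4) pp.252–253; Balaban1985Variational, (147)–(150) p.301] -/
theorem lift_mul_inv_eq_tau_mul_hinv_mul_of_door {K k : ℕ} (g₁ g₂ u' : GaugeTransf (F.P K) 0 (SU N)) (vfixV um h u₀ : Pt (F.P K).d → (MatA N)ˣ)
    (X : Set (Pt (F.P K).d))
    (hsid : ∀ x ∈ X, ιSU N (u' (cover (F.P K) (x + fun _ => ((ctrShift (F.P K).L k : ℕ) : ℤ)))) = (um x)⁻¹ * vfixV x)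
    (hvfix : ∀ x ∈ X, vfixV x = ιSU N (g₂ (cover (F.P K) (x + fun _ => ((ctrShift (F.P K).L k : ℕ) : ℤ)))))
    (hum : ∀ x ∈ X, um x = (h x)⁻¹ * u₀ x) :
    ∀ x ∈ X, (fun x => ιSU N ((fun x' => g₁ x' * (u' x')⁻¹) (cover (F.P K) (x + fun _ => ((ctrShift (F.P K).L k : ℕ) : ℤ))))) x =
      (((fun x => ιSU N ((fun x' => g₁ x' * (g₂ x')⁻¹) (cover (F.P K) (x + fun _ => ((ctrShift (F.P K).L k : ℕ) : ℤ))))) : Pt (F.P K).d → (MatA N)ˣ) * h⁻¹ * u₀) x := by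
  intro x hx
  simp only [Pi.mul_apply, Pi.inv_apply, map_mul, map_inv]
  rw [hsid x hx, hvfix x hx, hum x hx]
  simp only [mul_inv_rev, inv_inv, mul_assoc]

end AtRecordCube

end Summit.QuantumFields.YangMills.BalabanUVNodes.N07RecordCubeTowerWindow

end
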